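import Literature.NumberTheory.Transcendental.Waldschmidt1980Sizes
import Literature.NumberTheory.Transcendental.Waldschmidt1980Count
import HarnessLib

/-!
# Waldschmidt 1980, Prop. 3.8 over `ℚ` (`q = 2`): the sizes, II

Support file (theorems only; no named facts) for the archimedean input of the Stewart–Yu 1991
line of `Literature.Barriers.ABC.stewartYu1991_upperBound` (M. Waldschmidt, *A lower bound for
linear forms in logarithms*, Acta Arith. **37** (1980), Prop. 3.8 over `ℚ`, `q = 2`); sequel to
`Waldschmidt1980Sizes.lean`.

The counting of Siegel's lemma (with the factorial of `Waldschmidt1980Count.lean`), Baker's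
denominators `ν(x, h)^{τ₀} ≤ 𝔅` (affordable because `h ≍ W⋆/G`, `log((X+h)/h) ≤ 6G`), the values
of the `Δ`-polynomials `|qΔ|, |Qw| ≤ 𝔅`, and the composite bounds `|D · qTerm| ≤ 𝔅⁴ E₁²`
(Siegel), `|rHalf|, Dhalf ≤ 𝔅² E₁²` (half-integer Liouville), `DclearJ ≤ 𝔅² E₁^{2^{k+1}}`
(integer Liouville), `E₁ = exp(𝔘/(2c_L'))`, and the smallness parameter under `|Λ₀| ≤ e^{−U}`.

## References

* [Waldschmidt1980] M. Waldschmidt, *A lower bound for linear forms in logarithms*, Acta Arith. 37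
  (1980), 257–283 — §3.2–3.4 (pp. 264–270).
* [CijsouwWaldschmidt1977] P. L. Cijsouw, M. Waldschmidt, Compositio Math. 34 (1977) — §4.
* [BakerTNT1975] A. Baker, *Transcendental Number Theory*, CUP 1975, Ch. 3 §2 Lemma 1.
-/

noncomputable section

open Finset Real Polynomial
open Literature.NumberTheory.Transcendental.Baker1975
open Literature.NumberTheory.Transcendental.Baker1975.Ch3
open Literature.NumberTheory.Transcendental.Waldschmidt1980
open Literature.NumberTheory.Transcendental.Waldschmidt1980.W80Par

namespace Literature.NumberTheory.Transcendental.Waldschmidt1980.W80Par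

variable {d : ℕ} (P : W80Par d)

/-- Products of quantities `≤ 𝔅ⁱ`. [folklore] -/
theorem mul_le_𝔅_pow {a b : ℝ} {i j : ℕ} (ha : a ≤ P.𝔅 ^ i) (hb : b ≤ P.𝔅 ^ j) (hb0 : 0 ≤ b) :
    a * b ≤ P.𝔅 ^ (i + j) := by
  rw [pow_add]
  have h𝔅 := P.𝔅_pos
  calc a * b ≤ P.𝔅 ^ i * b := mul_le_mul_of_nonneg_right ha hb0
    _ ≤ P.𝔅 ^ i * P.𝔅 ^ j := mul_le_mul_of_nonneg_left hb (by positivity)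

/-- `m W⋆ ≤ 2⁻⁹⁰ 𝔘` (`𝔘 ≥ 2^{49m} W⋆ ≥ 2⁹⁰ 2ᵐ W⋆ ≥ 2⁹⁰ m W⋆`). [folklore] -/
theorem mW_le_𝔘 : (2 : ℝ) ^ 90 * (mR d * P.Wstar) ≤ P.𝔘 := by
  have h := P.𝔘_ge
  have hG := P.one_le_G; have hV := P.one_le_prodV; have hVθ := P.one_le_Vθ; have hW := P.one_le_Wstar
  have hm2 : mR d ≤ 2 ^ (d + 1) := by
    unfold mR
    have : ((d : ℝ) + 1) = ((d + 1 : ℕ) : ℝ) := by push_cast; ring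
    rw [this]; exact_mod_cast (Nat.lt_two_pow_self).le
  have hd := P.hd
  have hpow : (2 : ℝ) ^ 90 * mR d ≤ 2 ^ (49 * (d + 1)) := by
    calc (2 : ℝ) ^ 90 * mR d ≤ 2 ^ 90 * 2 ^ (d + 1) := by gcongr
      _ = 2 ^ (91 + d) := by rw [← pow_add]; ring_nf
      _ ≤ 2 ^ (49 * (d + 1)) := pow_le_pow_right₀ (by norm_num) (by omega)
  have hVV : 1 ≤ (∏ j, P.V j) * P.Vθ := by nlinarith
  calc (2 : ℝ) ^ 90 * (mR d * P.Wstar) = (2 ^ 90 * mR d) * P.Wstar := by ring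
    _ ≤ 2 ^ (49 * (d + 1)) * P.Wstar := by gcongr
    _ = 2 ^ (49 * (d + 1)) * 1 * 1 * P.Wstar := by ring
    _ ≤ 2 ^ (49 * (d + 1)) * P.G * ((∏ j, P.V j) * P.Vθ) * P.Wstar := by
        have h49 : (0 : ℝ) ≤ 2 ^ (49 * (d + 1)) := pow_nonneg zero_le_two _
        have hG0 : 0 ≤ P.G := by linarith
        exact mul_le_mul_of_nonneg_right
          (mul_le_mul (mul_le_mul_of_nonneg_left hG h49) hVV zero_le_one (mul_nonneg h49 hG0)) (by linarith)
    _ ≤ P.𝔘 := h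

/-- `2^{49m} ≤ 𝔘`. [folklore] -/
theorem pow49_le_𝔘 : (2 : ℝ) ^ (49 * (d + 1)) ≤ P.𝔘 := by
  have h := P.𝔘_ge
  have hG := P.one_le_G; have hV := P.one_le_prodV; have hVθ := P.one_le_Vθ; have hW := P.one_le_Wstar
  have hVV : 1 ≤ (∏ j, P.V j) * P.Vθ := by nlinarith
  have h49 : (0 : ℝ) ≤ 2 ^ (49 * (d + 1)) := pow_nonneg zero_le_two _
  calc (2 : ℝ) ^ (49 * (d + 1)) = 2 ^ (49 * (d + 1)) * 1 * 1 * 1 := by ring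
    _ ≤ 2 ^ (49 * (d + 1)) * P.G * ((∏ j, P.V j) * P.Vθ) * P.Wstar := by
        have hG0 : 0 ≤ P.G := by linarith
        exact mul_le_mul (mul_le_mul (mul_le_mul_of_nonneg_left hG h49) hVV zero_le_one (mul_nonneg h49 hG0)) hW
          zero_le_one (mul_nonneg (mul_nonneg h49 hG0) (by linarith))
    _ ≤ P.𝔘 := h

/-- `U = 2ᵐ 𝔘 ≤ 𝔘²`. [folklore] -/
theorem U_le_𝔘_sq : P.U ≤ P.𝔘 ^ 2 := by
  rw [P.U_eq, sq]
  have h1 : (2 : ℝ) ^ (d + 1) ≤ 2 ^ (49 * (d + 1)) := pow_le_pow_right₀ (by norm_num) (by omega)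
  have h2 := P.pow49_le_𝔘
  have hU := P.𝔘_pos
  nlinarith

/-- **`U ≤ 𝔅`** (`𝔘² ≤ exp(𝔘/64)` as `𝔘 ≥ 2⁹⁸`). [folklore] -/
theorem U_le_𝔅 : P.U ≤ P.𝔅 := by
  refine P.U_le_𝔘_sq.trans ?_
  unfold 𝔅
  set y := P.𝔘 / 64 with hy
  have hy1 : (2 : ℝ) ^ 90 ≤ y := by
    rw [hy, le_div_iff₀ (by norm_num)]
    have := P.𝔘_ge'
    calc (2 : ℝ) ^ 90 * 64 = 2 ^ 96 := by norm_num
      _ ≤ 2 ^ 98 := by norm_num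
      _ ≤ P.𝔘 := this
  have hy0 : 0 ≤ y := le_trans (by positivity) hy1
  have e : P.𝔘 = 64 * y := by rw [hy]; ring
  rw [e]
  -- `exp y = exp(y/3)^3 ≥ (y/3)^3 ≥ (64 y)^2`
  have h1 : y / 3 ≤ Real.exp (y / 3) := by linarith [Real.add_one_le_exp (y / 3)]
  have h2 : (y / 3) ^ 3 ≤ Real.exp y := by
    calc (y / 3) ^ 3 ≤ Real.exp (y / 3) ^ 3 := pow_le_pow_left₀ (by positivity) h1 3
      _ = Real.exp y := by rw [← Real.exp_nat_mul]; ring_nf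
  have h3 : (64 * y) ^ 2 ≤ (y / 3) ^ 3 := by
    have : (64 : ℝ) ^ 2 * 27 ≤ y := le_trans (by norm_num) hy1
    nlinarith [sq_nonneg y]
  exact h3.trans h2

/-- `T^T ≤ exp(𝔘/256)` (`T log T ≤ 10 T W⋆ ≤ 10 𝔘/c_T`). [folklore] -/
theorem T_pow_T_le : (P.T : ℝ) ^ P.T ≤ Real.exp (P.𝔘 / 256) := by
  have hT := P.T_pos
  rw [← Real.exp_log hT, ← Real.exp_nat_mul, Real.exp_le_exp]
  have h1 := P.log_T_le; have h2 := P.TWstar_le; have hU := P.𝔘_pos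
  calc (P.T : ℝ) * Real.log P.T ≤ P.T * (10 * P.Wstar) := mul_le_mul_of_nonneg_left h1 hT.le
    _ = 10 * (P.T * P.Wstar) := by ring
    _ ≤ 10 * (P.𝔘 / cT) := by gcongr
    _ ≤ P.𝔘 / 256 := by unfold cT; nlinarith

/-- `T^k ≤ exp(𝔘/256)` for `k ≤ T`. [folklore] -/
theorem T_pow_le {k : ℕ} (hk : k ≤ P.T) : (P.T : ℝ) ^ k ≤ Real.exp (P.𝔘 / 256) := by
  have h1 : (1 : ℝ) ≤ P.T := by exact_mod_cast P.one_le_T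
  exact (pow_le_pow_right₀ h1 hk).trans P.T_pow_T_le

/-- `2^{h L_b} ≤ exp(𝔘/256)` (`h L_b ≤ 𝔘/c_L + 3W⋆`). [folklore] -/
theorem two_pow_hLb_le : (2 : ℝ) ^ (P.hpar * P.Lb) ≤ Real.exp (P.𝔘 / 256) := by
  have h2 : (2 : ℝ) = Real.exp (Real.log 2) := (Real.exp_log two_pos).symm
  rw [h2, ← Real.exp_nat_mul, Real.exp_le_exp]
  push_cast
  have h1 := P.hparLb_le; have hW := P.Wstar_le_𝔘; have hU := P.𝔘_pos
  have hl2 : Real.log 2 ≤ 1 := by linarith [Real.log_two_lt_d9]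
  have hl0 : 0 ≤ Real.log 2 := Real.log_nonneg one_le_two
  have h0 : (0 : ℝ) ≤ P.hpar * P.Lb := by positivity
  calc ((P.hpar : ℝ) * P.Lb) * Real.log 2 ≤ (P.hpar * P.Lb) * 1 := mul_le_mul_of_nonneg_left hl2 h0
    _ ≤ P.𝔘 / cL + 3 * P.Wstar := by linarith
    _ ≤ P.𝔘 / 256 := by unfold cL; nlinarith

/-- **`(e(x+h)/h)^{h L_b} ≤ exp(𝔘/256)`** for `x ≤ X` (the binomial factors of the
`Δ`-polynomials: `h L_b (1 + 6G) ≤ 7(𝔘/c_L + W⋆ + G)`). [cite: Waldschmidt1980, (3.13)–(3.14) (p. 265)] -/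
theorem ratio_pow_le {x : ℕ} (hx : (x : ℝ) ≤ P.Xpt) :
    (Real.exp 1 * ((x : ℝ) + P.hpar) / P.hpar) ^ (P.hpar * P.Lb) ≤ Real.exp (P.𝔘 / 256) := by
  have hh := P.hpar_pos
  have hbase : 1 ≤ Real.exp 1 * ((x : ℝ) + P.hpar) / P.hpar := by
    rw [le_div_iff₀ hh]
    have := Real.exp_one_gt_two; have := Nat.cast_nonneg (α := ℝ) x
    nlinarith
  have hpos : 0 < Real.exp 1 * ((x : ℝ) + P.hpar) / P.hpar := by linarith
  rw [← Real.exp_log hpos, ← Real.exp_nat_mul, Real.exp_le_exp]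
  have h1 : Real.log (Real.exp 1 * ((x : ℝ) + P.hpar) / P.hpar) = 1 + Real.log (((x : ℝ) + P.hpar) / P.hpar) := by
    rw [mul_div_assoc, Real.log_mul (Real.exp_pos 1).ne' (by positivity), Real.log_exp]
  rw [h1]
  have h2 : Real.log (((x : ℝ) + P.hpar) / P.hpar) ≤ 6 * P.G := by
    refine le_trans (Real.log_le_log (by positivity) ?_) P.log_Xpt_div_le
    exact div_le_div_of_nonneg_right (by linarith) hh.le
  have hG := P.one_le_G
  have h3 := P.hparLbG_le; have hW := P.Wstar_le_𝔘; have hGU := P.G_le_𝔘; have hU := P.𝔘_pos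
  have h0 : (0 : ℝ) ≤ P.hpar * P.Lb := by positivity
  push_cast
  calc ((P.hpar : ℝ) * P.Lb) * (1 + Real.log (((x : ℝ) + P.hpar) / P.hpar))
      ≤ (P.hpar * P.Lb) * (7 * P.G) := mul_le_mul_of_nonneg_left (by linarith) h0
    _ = 7 * (P.hpar * P.Lb * P.G) := by ring
    _ ≤ 7 * (P.𝔘 / cL + (P.Wstar + P.G)) := by gcongr
    _ ≤ P.𝔘 / 256 := by unfold cL; nlinarith

/-- `exp(𝔘/256)⁴ = 𝔅`. [folklore] -/
theorem exp_quarter_pow_four : Real.exp (P.𝔘 / 256) ^ 4 = P.𝔅 := by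
  unfold 𝔅; rw [← Real.exp_nat_mul]; ring_nf

/-! ### Baker's denominators -/

omit P in
/-- `log ν(x, h) ≤ h (6 + 9 log((x+h)/h))` also for `h = 1` (`ν(x, 1) = x + 1`). [cite: BakerTNT1975, Ch. 3 §2 Lemma 1] -/
theorem log_nuBound_le_one_le {x h : ℕ} (hh : 1 ≤ h) :
    Real.log (nuBound x h) ≤ h * (6 + 9 * Real.log ((x + h : ℝ) / h)) := by
  rcases Nat.lt_or_ge h 2 with h1 | h2
  · have h1' : h = 1 := by omega
    subst h1'
    have hpb : Nat.primesBelow 2 = ∅ := by decide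
    have hnu : nuBound x 1 = x + 1 := by
      unfold nuBound
      rw [hpb, Finset.prod_empty, one_mul, Nat.choose_one_right]
    rw [hnu]
    push_cast
    rw [div_one, one_mul]
    have hlog : 0 ≤ Real.log ((x : ℝ) + 1) := Real.log_nonneg (by have := Nat.cast_nonneg (α := ℝ) x; linarith)
    linarith
  · exact log_nuBound_le h2

/-- **`ν(x, h)^k ≤ 𝔅`** for `x ≤ X`, `k ≤ T`: `T h (6 + 54 G) ≤ 60 T (W⋆ + G) ≤ 180 𝔘/c_T`.
[cite: Waldschmidt1980, §3.4 (3.21) (p. 269)] [cite: BakerTNT1975, Ch. 3 §2 Lemma 1] -/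
theorem nuBound_pow_le_𝔅 {x k : ℕ} (hx : (x : ℝ) ≤ P.Xpt) (hk : k ≤ P.T) :
    ((nuBound x P.hpar : ℕ) : ℝ) ^ k ≤ P.𝔅 := by
  have hν1 : (1 : ℝ) ≤ nuBound x P.hpar := by exact_mod_cast nuBound_pos x P.hpar
  refine (pow_le_pow_right₀ hν1 hk).trans (P.le_𝔅_of_log_le ?_)
  rw [Real.log_pow]
  have h1 := log_nuBound_le_one_le (x := x) P.one_le_hpar
  have hh := P.hpar_pos
  have h2 : Real.log (((x : ℝ) + P.hpar) / P.hpar) ≤ 6 * P.G := by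
    refine le_trans (Real.log_le_log (by positivity) ?_) P.log_Xpt_div_le
    exact div_le_div_of_nonneg_right (by linarith) hh.le
  have hG := P.one_le_G
  have h3 : Real.log (nuBound x P.hpar) ≤ P.hpar * (60 * P.G) := by
    refine h1.trans (mul_le_mul_of_nonneg_left ?_ hh.le)
    linarith
  have hT := P.T_pos; have hTW := P.TWstar_le; have hGW := P.G_le_two_Wstar; have hhG := P.hparG_le
  have hU := P.𝔘_pos
  calc (P.T : ℝ) * Real.log (nuBound x P.hpar) ≤ P.T * (P.hpar * (60 * P.G)) := mul_le_mul_of_nonneg_left h3 hT.le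
    _ = 60 * P.T * (P.hpar * P.G) := by ring
    _ ≤ 60 * P.T * (P.Wstar + P.G) := by gcongr
    _ ≤ 60 * P.T * (3 * P.Wstar) := by gcongr; linarith
    _ = 180 * (P.T * P.Wstar) := by ring
    _ ≤ 180 * (P.𝔘 / cT) := by gcongr
    _ ≤ P.𝔘 / 64 := by unfold cT; nlinarith

/-- **`2 kpts^{t+1} t ≤ 𝔅`** for `kpts ≤ 2^{d+J₀} S₀`, `t ≤ T` (the polynomial factor of the
Hermite bound). [folklore] -/
theorem two_kpts_pow_le {kpts t : ℕ} (hk : kpts ≤ 2 ^ (d + P.J₀) * P.S₀) (ht : t ≤ P.T) :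
    2 * (kpts : ℝ) ^ (t + 1) * (t : ℝ) ≤ P.𝔅 := by
  -- `kpts ≤ 2^{d+1} Lθ S₀ ≤ U`, `t ≤ T ≤ U`, so the quantity is `≤ 2 U^{T+2}`, `log ≤ 1 + (T+2) 10 W⋆`
  have hU1 : (1 : ℝ) ≤ P.U := by
    have := P.𝔘_ge'; rw [P.U_eq]
    have : (1 : ℝ) ≤ 2 ^ (d + 1) := one_le_pow₀ (by norm_num)
    nlinarith
  have hkU : (kpts : ℝ) ≤ P.U := by
    have h1 : (kpts : ℝ) ≤ 2 ^ (d + P.J₀) * P.S₀ := by exact_mod_cast hk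
    have h2 : (2 : ℝ) ^ (d + P.J₀) * P.S₀ ≤ 2 ^ d * (2 * P.Lθ) * P.S₀ := by
      rw [pow_add]
      have h3 : ((2 : ℝ) ^ P.J₀) ≤ 2 * P.Lθ := by exact_mod_cast P.two_pow_le
      have : (0 : ℝ) ≤ P.S₀ := Nat.cast_nonneg _
      gcongr
    have h4 := P.LθS₀_le
    have h5 : (2 : ℝ) ^ d * (2 * P.Lθ) * P.S₀ ≤ P.U := by
      rw [P.U_eq, pow_succ]
      have hUpos := P.𝔘_pos
      nlinarith [pow_nonneg (zero_le_two (α := ℝ)) d]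
    linarith
  have htU : (t : ℝ) ≤ P.U := by
    have h1 : (t : ℝ) ≤ P.T := by exact_mod_cast ht
    have h2 := P.T_le_𝔘
    have h3 : P.𝔘 / cT ≤ P.U := by
      rw [P.U_eq]; unfold cT
      have := P.𝔘_pos
      have : (1 : ℝ) ≤ 2 ^ (d + 1) := one_le_pow₀ (by norm_num)
      rw [div_le_iff₀ (by norm_num)]; nlinarith
    linarith
  have h1 : 2 * (kpts : ℝ) ^ (t + 1) * (t : ℝ) ≤ 2 * P.U ^ (P.T + 2) := by
    have h2 : (kpts : ℝ) ^ (t + 1) ≤ P.U ^ (t + 1) := pow_le_pow_left₀ (Nat.cast_nonneg _) hkU _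
    have h3 : P.U ^ (t + 1) ≤ P.U ^ (P.T + 1) := pow_le_pow_right₀ hU1 (by omega)
    calc 2 * (kpts : ℝ) ^ (t + 1) * (t : ℝ) ≤ 2 * P.U ^ (P.T + 1) * P.U :=
          mul_le_mul (mul_le_mul_of_nonneg_left (h2.trans h3) (by norm_num)) htU (Nat.cast_nonneg _) (by positivity)
      _ = 2 * P.U ^ (P.T + 2) := by ring
  refine h1.trans (P.le_𝔅_of_log_le ?_)
  rw [Real.log_mul (by norm_num) (by positivity), Real.log_pow]
  have hlog := P.log_U_le
  have hl2 : Real.log 2 ≤ 1 := by linarith [Real.log_two_lt_d9]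
  have hTW := P.TWstar_le; have hW := P.Wstar_le_𝔘; have hU := P.𝔘_pos; have hW1 := P.one_le_Wstar
  have h5 : ((P.T + 2 : ℕ) : ℝ) * Real.log P.U ≤ 10 * (P.T * P.Wstar) + 20 * P.Wstar := by
    push_cast
    have hT0 : (0 : ℝ) ≤ P.T := Nat.cast_nonneg _
    nlinarith
  calc Real.log 2 + ((P.T + 2 : ℕ) : ℝ) * Real.log P.U ≤ 1 + (10 * (P.𝔘 / cT) + 20 * P.Wstar) := by
        have : 10 * ((P.T : ℝ) * P.Wstar) ≤ 10 * (P.𝔘 / cT) := by linarith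
        linarith
    _ ≤ P.𝔘 / 64 := by unfold cT; nlinarith

/-- **`(2 Cl)^t ≤ 𝔅`** with `Cl = 1 + ∑ Vⱼ ≥ 1 + ∑|lⱼ|` and `t ≤ T`. [folklore] -/
theorem two_Cl_pow_le {t : ℕ} (ht : t ≤ P.T) : (2 * (1 + ∑ j, P.V j)) ^ t ≤ P.𝔅 := by
  have hV1 := P.one_le_prodV
  have hsum : 0 ≤ ∑ j, P.V j := sum_nonneg fun j _ => le_trans zero_le_one (P.hV j)
  have hC1 : (1 : ℝ) ≤ 2 * (1 + ∑ j, P.V j) := by linarith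
  refine (pow_le_pow_right₀ hC1 ht).trans (P.le_𝔅_of_log_le ?_)
  rw [Real.log_pow]
  -- `2(1 + ∑V) ≤ 2^{90}·(stuff) ≤ 𝔘`, crude: `log(2(1+∑V)) ≤ 2(1 + ∑V) ≤ 2 + 2 𝔘/2^90`… but multiplied by `T`
  -- this is too big; instead `1 + ∑ Vⱼ ≤ (d+1) Vθ ≤ 2^13 m Vθ`, so `log(2(1+∑V)) ≤ log 2 + W⋆/m ≤ 1 + W⋆`.
  have hVle : ∀ j, P.V j ≤ P.Vθ := fun j => (P.hVf j).trans P.hVfθ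
  have hm := two_le_mR P; have hm0 := mR_pos P; have hVθ := P.one_le_Vθ
  have h1 : 1 + ∑ j, P.V j ≤ mR d * P.Vθ := by
    calc 1 + ∑ j, P.V j ≤ P.Vθ + ∑ _j : Fin d, P.Vθ := add_le_add hVθ (sum_le_sum fun j _ => hVle j)
      _ = mR d * P.Vθ := by simp only [sum_const, card_univ, Fintype.card_fin, nsmul_eq_mul]; unfold mR; ring
  have h2 : Real.log (2 * (1 + ∑ j, P.V j)) ≤ 1 + P.Wstar := by
    have h3 : 2 * (1 + ∑ j, P.V j) ≤ 2 ^ 13 * mR d * P.Vθ := by nlinarith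
    have h4 : Real.log (2 * (1 + ∑ j, P.V j)) ≤ Real.log (2 ^ 13 * mR d * P.Vθ) :=
      Real.log_le_log (by positivity) h3
    have h5 : Real.log (2 ^ 13 * mR d * P.Vθ) ≤ P.Wstar := by
      have h6 := P.mlog_le_Wstar
      have h7 : 0 ≤ Real.log (2 ^ 13 * mR d * P.Vθ) := by linarith [P.nine_le_log]
      nlinarith
    linarith
  have hT := P.T_pos; have hTW := P.TWstar_le; have hTU := P.T_le_𝔘; have hU := P.𝔘_pos
  calc (P.T : ℝ) * Real.log (2 * (1 + ∑ j, P.V j)) ≤ P.T * (1 + P.Wstar) :=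
        mul_le_mul_of_nonneg_left h2 hT.le
    _ = P.T + P.T * P.Wstar := by ring
    _ ≤ P.𝔘 / cT + P.𝔘 / cT := add_le_add hTU hTW
    _ ≤ P.𝔘 / 64 := by unfold cT; nlinarith

end Literature.NumberTheory.Transcendental.Waldschmidt1980.W80Par

namespace Literature.NumberTheory.Transcendental.CW77

namespace Setup

variable {S : Setup} {P : W80Par S.d} (hy : S.W80Hyp P)
include hy

/-- **`|b_θ|^k ≤ 𝔅`** for `k ≤ T` (`k W ≤ T W⋆ ≤ 𝔘/c_T`). [folklore] -/
theorem W80Hyp.natAbs_bθ_pow_le {k : ℕ} (hk : k ≤ P.T) : ((S.bθ.natAbs ^ k : ℕ) : ℝ) ≤ P.𝔅 := by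
  have hB0 : 0 < Real.exp P.W := Real.exp_pos _
  have hB1 : 1 ≤ Real.exp P.W := Real.one_le_exp (by linarith [P.hW])
  have h1 : ((S.bθ.natAbs ^ k : ℕ) : ℝ) ≤ Real.exp P.W ^ P.T := by
    push_cast
    rw [Nat.cast_natAbs, Int.cast_abs]
    exact (pow_le_pow_left₀ (abs_nonneg _) hy.hbθ k).trans (pow_le_pow_right₀ hB1 hk)
  refine h1.trans ?_
  rw [← Real.exp_nat_mul]
  refine P.exp_le_𝔅 ?_
  have hTW := P.TWstar_le; have hW := P.W_le_Wstar; have hT := P.T_pos; have hU := P.𝔘_pos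
  calc (P.T : ℝ) * P.W ≤ P.T * P.Wstar := mul_le_mul_of_nonneg_left hW hT.le
    _ ≤ P.𝔘 / cT := hTW
    _ ≤ P.𝔘 / 64 := by unfold cT; rw [div_le_div_iff₀ (by norm_num) (by norm_num)]; nlinarith

omit hy in
/-- `scale(J₀, J) = 2^{J₀−J} ≤ 2 L_θ ≤ T`. [folklore] -/
theorem w80_scale_le_T (P : W80Par S.d) (J : ℕ) : scale P.J₀ J ≤ P.T := by
  unfold scale
  have h1 : 2 ^ (P.J₀ - J) ≤ 2 ^ P.J₀ := Nat.pow_le_pow_right two_pos (Nat.sub_le _ _)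
  have h2 := P.two_pow_le
  have h3 : 2 * P.Lθ ≤ P.T := by
    have h := P.T_ge_Lθ
    have hm := two_le_mR P; have hV := P.one_le_Vθ
    have hL : (0 : ℝ) ≤ P.Lθ := Nat.cast_nonneg _
    have : (2 : ℝ) * P.Lθ ≤ 2 ^ 11 * mR S.d ^ 2 * P.Vθ * P.Lθ := by
      have h4 : (2 : ℝ) ≤ 2 ^ 11 * mR S.d ^ 2 * P.Vθ := by nlinarith
      nlinarith
    exact_mod_cast this.trans h
  omega

omit hy in
/-- **The evaluation points are `≤ X`**: `scale(J₀,J) · s ≤ X = 66 · 2^{d+1} L_θ S₀` for `J ≤ J₀`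
and `s ≤ 2^{d+1+J} S₀`. [folklore] -/
theorem w80_scale_mul_le_Xpt (P : W80Par S.d) {J s : ℕ} (hJ : J ≤ P.J₀) (hs : s ≤ 2 ^ (S.d + 1 + J) * P.S₀) :
    ((scale P.J₀ J * s : ℕ) : ℝ) ≤ P.Xpt := by
  have h1 : scale P.J₀ J * s ≤ 2 ^ (S.d + 1) * (2 * P.Lθ) * P.S₀ := by
    unfold scale
    calc 2 ^ (P.J₀ - J) * s ≤ 2 ^ (P.J₀ - J) * (2 ^ (S.d + 1 + J) * P.S₀) := Nat.mul_le_mul_left _ hs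
      _ = 2 ^ (S.d + 1) * 2 ^ P.J₀ * P.S₀ := by
          rw [show S.d + 1 + J = J + (S.d + 1) by ring, pow_add, ← Nat.mul_assoc, ← Nat.mul_assoc, ← pow_add,
            Nat.sub_add_cancel hJ]; ring
      _ ≤ 2 ^ (S.d + 1) * (2 * P.Lθ) * P.S₀ := Nat.mul_le_mul_right _ (Nat.mul_le_mul_left _ P.two_pow_le)
  have h2 : ((2 ^ (S.d + 1) * (2 * P.Lθ) * P.S₀ : ℕ) : ℝ) ≤ P.Xpt := by
    unfold W80Par.Xpt; push_cast
    have : (0 : ℝ) ≤ 2 ^ (S.d + 1) * P.Lθ * P.S₀ := by positivity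
    nlinarith
  exact le_trans (by exact_mod_cast h1) h2

/-! ### The `Δ`-polynomials -/

omit hy in
/-- **`|qΔ| ≤ 𝔅`**: the size of the rational values of the `Δ`-factors at the points
`x = 2^{J₀−J} s ≤ X`, `τ₀ ≤ T`. [cite: Waldschmidt1980, §3.4 (p. 269)] [cite: BakerTNT1975, Ch. 3 §2 Lemma 1] -/
theorem w80_abs_qΔ_le (P : W80Par S.d) {J : ℕ} (hJ : J ≤ P.J₀) (u : Idx S.d P.hpar P.Lb)
    {τ₀ s : ℕ} (hs : s ≤ 2 ^ (S.d + 1 + J) * P.S₀) (hτ : τ₀ ≤ P.T) :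
    |(S.qΔ (h := P.hpar) P.J₀ J u τ₀ s : ℝ)| ≤ P.𝔅 := by
  set x := scale P.J₀ J * s with hxdef
  have hxX : (x : ℝ) ≤ P.Xpt := w80_scale_mul_le_Xpt P hJ hs
  set a : ℕ := (u.1.1 : ℕ) with ha
  set b : ℕ := (u.1.2 : ℕ) with hb
  have hR1 := P.one_le_hpar
  have hspec := (hdNat_spec (b := b) (le_of_lt u.1.1.isLt) x τ₀).2
  have hνpos : (0 : ℝ) < ((nuBound x P.hpar) ^ τ₀ : ℕ) := by exact_mod_cast Nat.pow_pos (nuBound_pos _ _)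
  have h1 : |(S.qΔ (h := P.hpar) P.J₀ J u τ₀ s : ℝ)| ≤
      (τ₀.factorial : ℝ) * (scale P.J₀ J : ℝ) ^ τ₀ * (2 ^ (a + b * P.hpar) * ((x + a).choose a * (x + P.hpar).choose P.hpar ^ b : ℕ) : ℝ) := by
    unfold qΔ
    rw [← hxdef]
    push_cast
    rw [abs_of_nonneg (by positivity), div_le_iff₀ (by push_cast at hνpos; exact_mod_cast hνpos)]
    have hE : ((hdNat (b := b) (le_of_lt u.1.1.isLt) x τ₀ : ℕ) : ℝ) ≤
        ((2 ^ (a + b * P.hpar) * nuBound x P.hpar ^ τ₀ * ((x + a).choose a * (x + P.hpar).choose P.hpar ^ b) : ℕ) : ℝ) := by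
      exact_mod_cast hspec
    push_cast at hE ⊢
    have h0 : (0 : ℝ) ≤ (τ₀.factorial : ℝ) * (scale P.J₀ J : ℝ) ^ τ₀ := by positivity
    calc (τ₀.factorial : ℝ) * (scale P.J₀ J : ℝ) ^ τ₀ * (hdNat (b := b) (le_of_lt u.1.1.isLt) x τ₀ : ℝ)
        ≤ (τ₀.factorial : ℝ) * (scale P.J₀ J : ℝ) ^ τ₀ *
          (2 ^ (a + b * P.hpar) * (nuBound x P.hpar : ℝ) ^ τ₀ * (((x + a).choose a : ℝ) * ((x + P.hpar).choose P.hpar : ℝ) ^ b)) :=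
          mul_le_mul_of_nonneg_left hE h0
      _ = (τ₀.factorial : ℝ) * (scale P.J₀ J : ℝ) ^ τ₀ *
          (2 ^ (a + b * P.hpar) * (((x + a).choose a : ℝ) * ((x + P.hpar).choose P.hpar : ℝ) ^ b)) * (nuBound x P.hpar : ℝ) ^ τ₀ := by
          ring
  -- the four factors, each `≤ exp(𝔘/256)`
  have hT1 : (1 : ℝ) ≤ P.T := by exact_mod_cast P.one_le_T
  have hf1 : (τ₀.factorial : ℝ) ≤ Real.exp (P.𝔘 / 256) := by
    have h2 : (τ₀.factorial : ℝ) ≤ (τ₀ : ℝ) ^ τ₀ := by exact_mod_cast Nat.factorial_le_pow τ₀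
    have h3 : (τ₀ : ℝ) ^ τ₀ ≤ (P.T : ℝ) ^ τ₀ := pow_le_pow_left₀ (Nat.cast_nonneg _) (by exact_mod_cast hτ) _
    exact h2.trans (h3.trans (P.T_pow_le hτ))
  have hf2 : (scale P.J₀ J : ℝ) ^ τ₀ ≤ Real.exp (P.𝔘 / 256) := by
    have h2 : (scale P.J₀ J : ℝ) ≤ P.T := by exact_mod_cast w80_scale_le_T P J
    exact (pow_le_pow_left₀ (Nat.cast_nonneg _) h2 _).trans (P.T_pow_le hτ)
  have hab : a + b * P.hpar ≤ P.hpar * P.Lb := by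
    have ha' : a < P.hpar := u.1.1.isLt
    have hb' : b < P.Lb := u.1.2.isLt
    calc a + b * P.hpar ≤ P.hpar + b * P.hpar := by omega
      _ = (b + 1) * P.hpar := by ring
      _ ≤ P.Lb * P.hpar := Nat.mul_le_mul_right _ hb'
      _ = P.hpar * P.Lb := Nat.mul_comm _ _
  have hf3 : (2 : ℝ) ^ (a + b * P.hpar) ≤ Real.exp (P.𝔘 / 256) :=
    (pow_le_pow_right₀ (by norm_num) hab).trans P.two_pow_hLb_le
  have hf4 : (((x + a).choose a * (x + P.hpar).choose P.hpar ^ b : ℕ) : ℝ) ≤ Real.exp (P.𝔘 / 256) := by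
    have hC : ((x + a).choose a : ℝ) ≤ (x + P.hpar).choose P.hpar := by
      have : (x + a).choose a ≤ (x + P.hpar).choose P.hpar := by
        have e1 : (x + a).choose a = (x + a).choose x := (Nat.choose_symm_add (a := x) (b := a)).symm
        have e2 : (x + P.hpar).choose P.hpar = (x + P.hpar).choose x := (Nat.choose_symm_add (a := x) (b := P.hpar)).symm
        rw [e1, e2]
        exact Nat.choose_le_choose x (by have := u.1.1.isLt; omega)
      exact_mod_cast this
    have hCe := choose_le_exp_mul_div_pow (x := x) hR1
    have hbase : 1 ≤ Real.exp 1 * ((x : ℝ) + P.hpar) / P.hpar := by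
      rw [le_div_iff₀ P.hpar_pos]
      have := Real.exp_one_gt_two; have := Nat.cast_nonneg (α := ℝ) x
      nlinarith
    push_cast
    calc ((x + a).choose a : ℝ) * ((x + P.hpar).choose P.hpar : ℝ) ^ b ≤ ((x + P.hpar).choose P.hpar : ℝ) ^ (b + 1) := by
          rw [pow_succ]; nlinarith [pow_nonneg (Nat.cast_nonneg (α := ℝ) ((x + P.hpar).choose P.hpar)) b]
      _ ≤ ((Real.exp 1 * (x + P.hpar) / P.hpar) ^ P.hpar) ^ (b + 1) := pow_le_pow_left₀ (Nat.cast_nonneg _) hCe _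
      _ = (Real.exp 1 * ((x : ℝ) + P.hpar) / P.hpar) ^ (P.hpar * (b + 1)) := by rw [← pow_mul]
      _ ≤ (Real.exp 1 * ((x : ℝ) + P.hpar) / P.hpar) ^ (P.hpar * P.Lb) := by
          refine pow_le_pow_right₀ hbase (Nat.mul_le_mul_left _ ?_)
          exact u.1.2.isLt
      _ ≤ Real.exp (P.𝔘 / 256) := P.ratio_pow_le hxX
  refine h1.trans ?_
  have hE := Real.exp_pos (P.𝔘 / 256)
  calc (τ₀.factorial : ℝ) * (scale P.J₀ J : ℝ) ^ τ₀ *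
        (2 ^ (a + b * P.hpar) * ((x + a).choose a * (x + P.hpar).choose P.hpar ^ b : ℕ) : ℝ)
      ≤ Real.exp (P.𝔘 / 256) * Real.exp (P.𝔘 / 256) * (Real.exp (P.𝔘 / 256) * Real.exp (P.𝔘 / 256)) := by
        refine mul_le_mul (mul_le_mul hf1 hf2 (by positivity) hE.le) (mul_le_mul hf3 hf4 (by positivity) hE.le)
          (by positivity) (by positivity)
    _ = Real.exp (P.𝔘 / 256) ^ 4 := by ring
    _ = P.𝔅 := P.exp_quarter_pow_four

omit hy in
/-- **`|Qw m (w_u(2^{J₀−J} ·)) 0 z| ≤ 𝔅`** for `m ≤ T`, `|z| ≤ 65 · 2^{d+J} S₀`, `J ≤ J₀`: the size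
of the `Δ`-factors of `f_{J,τ}` on the far circles. [cite: Waldschmidt1980, §3.4 (p. 270)] -/
theorem w80_norm_Qw_wOf_le (P : W80Par S.d) {J : ℕ} (hJ : J ≤ P.J₀)
    (u : Idx S.d P.hpar P.Lb) {m : ℕ} (hm : m ≤ P.T) {z : ℂ}
    (hz : ‖z‖ ≤ 65 * ((2 ^ (S.d + J) * P.S₀ : ℕ) : ℝ)) :
    ‖Qw m (S.wOf (h := P.hpar) P.J₀ J u) 0 z‖ ≤ P.𝔅 := by
  set a : ℕ := (u.1.1 : ℕ) with ha
  set b : ℕ := (u.1.2 : ℕ) with hb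
  rw [Qw_zero_right, iterate_derivative_eval_eq_factorial_mul_hasseDeriv, norm_mul, Complex.norm_natCast]
  have hR1 := P.one_le_hpar
  have h1 := norm_hasseDeriv_wPoly_comp_eval_le (b := b) (le_of_lt u.1.1.isLt) hR1 (2 ^ (P.J₀ - J)) z m
  have hwOf : S.wOf (h := P.hpar) P.J₀ J u = (wPoly a b P.hpar).comp (C ((2 ^ (P.J₀ - J) : ℕ) : ℂ) * X) := rfl
  rw [hwOf]
  -- the point `⌈2^{J₀-J} |z|⌉ ≤ X`
  have hceil : ((⌈((2 ^ (P.J₀ - J) : ℕ) : ℝ) * ‖z‖⌉₊ : ℕ) : ℝ) ≤ P.Xpt := by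
    have h0 : (0 : ℝ) ≤ ((2 ^ (P.J₀ - J) : ℕ) : ℝ) * ‖z‖ := by positivity
    have hc := (Nat.ceil_lt_add_one h0).le
    refine hc.trans ?_
    have h2 : ((2 ^ (P.J₀ - J) : ℕ) : ℝ) * (65 * ((2 ^ (S.d + J) * P.S₀ : ℕ) : ℝ)) = 65 * 2 ^ S.d * ((2 ^ P.J₀ : ℕ) : ℝ) * P.S₀ := by
      push_cast
      rw [show (2 : ℝ) ^ P.J₀ = 2 ^ (P.J₀ - J) * 2 ^ J by rw [← pow_add, Nat.sub_add_cancel hJ], pow_add]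
      ring
    have h3 : ((2 ^ P.J₀ : ℕ) : ℝ) ≤ 2 * P.Lθ := by exact_mod_cast P.two_pow_le
    have hLS : (1 : ℝ) ≤ (P.Lθ : ℝ) * P.S₀ := by
      have h4 : (1 : ℝ) ≤ P.Lθ := by exact_mod_cast P.one_le_Lθ
      have h5 : (1 : ℝ) ≤ P.S₀ := by have := P.two_le_S₀; exact_mod_cast (by omega : 1 ≤ P.S₀)
      nlinarith
    have hS0 : (0 : ℝ) ≤ P.S₀ := Nat.cast_nonneg _
    calc ((2 ^ (P.J₀ - J) : ℕ) : ℝ) * ‖z‖ + 1 ≤ ((2 ^ (P.J₀ - J) : ℕ) : ℝ) * (65 * ((2 ^ (S.d + J) * P.S₀ : ℕ) : ℝ)) + 1 := by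
          gcongr
      _ = 65 * 2 ^ S.d * ((2 ^ P.J₀ : ℕ) : ℝ) * P.S₀ + 1 := by rw [h2]
      _ ≤ 65 * 2 ^ S.d * (2 * P.Lθ) * P.S₀ + 1 := by gcongr
      _ ≤ P.Xpt := by
          unfold W80Par.Xpt
          have : (1 : ℝ) ≤ 2 ^ S.d := one_le_pow₀ (by norm_num)
          rw [pow_succ]
          nlinarith
  -- the factors
  have hf1 : (m.factorial : ℝ) ≤ Real.exp (P.𝔘 / 256) := by
    have h2 : (m.factorial : ℝ) ≤ (m : ℝ) ^ m := by exact_mod_cast Nat.factorial_le_pow m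
    have h3 : (m : ℝ) ^ m ≤ (P.T : ℝ) ^ m := pow_le_pow_left₀ (Nat.cast_nonneg _) (by exact_mod_cast hm) _
    exact h2.trans (h3.trans (P.T_pow_le hm))
  have hf2 : (((2 ^ (P.J₀ - J) : ℕ) : ℝ)) ^ m ≤ Real.exp (P.𝔘 / 256) := by
    have h2 : ((2 ^ (P.J₀ - J) : ℕ) : ℝ) ≤ P.T := by exact_mod_cast w80_scale_le_T P J
    exact (pow_le_pow_left₀ (Nat.cast_nonneg _) h2 _).trans (P.T_pow_le hm)
  have hab : a + b * P.hpar ≤ P.hpar * P.Lb := by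
    have ha' : a < P.hpar := u.1.1.isLt
    have hb' : b < P.Lb := u.1.2.isLt
    calc a + b * P.hpar ≤ P.hpar + b * P.hpar := by omega
      _ = (b + 1) * P.hpar := by ring
      _ ≤ P.Lb * P.hpar := Nat.mul_le_mul_right _ hb'
      _ = P.hpar * P.Lb := Nat.mul_comm _ _
  have hf3 : (2 : ℝ) ^ (a + b * P.hpar) ≤ Real.exp (P.𝔘 / 256) :=
    (pow_le_pow_right₀ (by norm_num) hab).trans P.two_pow_hLb_le
  have hf4 : (Real.exp 1 * (⌈((2 ^ (P.J₀ - J) : ℕ) : ℝ) * ‖z‖⌉₊ + P.hpar) / P.hpar) ^ (P.hpar * (b + 1)) ≤ Real.exp (P.𝔘 / 256) := by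
    set y := ⌈((2 ^ (P.J₀ - J) : ℕ) : ℝ) * ‖z‖⌉₊ with hy
    have hbase : 1 ≤ Real.exp 1 * ((y : ℝ) + P.hpar) / P.hpar := by
      rw [le_div_iff₀ P.hpar_pos]
      have := Real.exp_one_gt_two; have := Nat.cast_nonneg (α := ℝ) y
      nlinarith
    calc (Real.exp 1 * ((y : ℝ) + P.hpar) / P.hpar) ^ (P.hpar * (b + 1))
        ≤ (Real.exp 1 * ((y : ℝ) + P.hpar) / P.hpar) ^ (P.hpar * P.Lb) := by
          refine pow_le_pow_right₀ hbase (Nat.mul_le_mul_left _ ?_); exact u.1.2.isLt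
      _ ≤ Real.exp (P.𝔘 / 256) := P.ratio_pow_le hceil
  have hE := Real.exp_pos (P.𝔘 / 256)
  calc (m.factorial : ℝ) * ‖(hasseDeriv m ((wPoly a b P.hpar).comp (C ((2 ^ (P.J₀ - J) : ℕ) : ℂ) * X))).eval z‖
      ≤ Real.exp (P.𝔘 / 256) * ((((2 ^ (P.J₀ - J) : ℕ) : ℝ)) ^ m * (2 ^ (a + b * P.hpar) *
          (Real.exp 1 * (⌈((2 ^ (P.J₀ - J) : ℕ) : ℝ) * ‖z‖⌉₊ + P.hpar) / P.hpar) ^ (P.hpar * (b + 1)))) :=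
        mul_le_mul hf1 h1 (norm_nonneg _) hE.le
    _ ≤ Real.exp (P.𝔘 / 256) * (Real.exp (P.𝔘 / 256) * (Real.exp (P.𝔘 / 256) * Real.exp (P.𝔘 / 256))) := by
        refine mul_le_mul_of_nonneg_left (mul_le_mul hf2 (mul_le_mul hf3 hf4 (by positivity) hE.le) (by positivity) hE.le) hE.le
    _ = Real.exp (P.𝔘 / 256) ^ 4 := by ring
    _ = P.𝔅 := P.exp_quarter_pow_four

/-- **The bound `Amax = 𝔅⁴ E₁²` of Siegel's step**: `|D(s,τ) · qTerm| ≤ 𝔅⁴ exp(2𝔘/(2c_L'))` on the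
box of level `0`, `s < S₀`, `|τ| < T`. [cite: Waldschmidt1980, Lemma 3.2 (pp. 266–267)] -/
theorem W80Hyp.abs_Dclear_qTerm_le {s : ℕ} (hs : s < P.S₀) {τ : Tau S.d} (hτ : tauNorm τ < P.T)
    {u : Idx S.d P.hpar P.Lb} (hu : u ∈ S.box (h := P.hpar) (Lb := P.Lb) P.L P.Lθ 0) :
    |((S.Dclear (h := P.hpar) P.J₀ P.L P.Lθ s τ : ℕ) : ℝ) * (S.qTerm (h := P.hpar) P.J₀ 0 u τ s : ℝ)| ≤
      P.𝔅 ^ 4 * Real.exp (2 * (P.𝔘 / (2 * cL'))) := by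
  have hτ1 : τ.1 ≤ P.T := by unfold tauNorm at hτ; omega
  have hτ2 : ∑ j, τ.2 j ≤ P.T := by unfold tauNorm at hτ; omega
  have hs' : s ≤ 2 ^ (S.d + 1 + 0) * P.S₀ := by
    have : P.S₀ ≤ 2 ^ (S.d + 1 + 0) * P.S₀ := Nat.le_mul_of_pos_left _ (Nat.pow_pos two_pos)
    omega
  have hx : ((scale P.J₀ 0 * s : ℕ) : ℝ) ≤ P.Xpt := w80_scale_mul_le_Xpt P (Nat.zero_le _) hs'
  have h𝔅 := P.𝔅_pos
  -- the denominator `≤ 𝔅² E₁`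
  have hD : ((S.Dclear (h := P.hpar) P.J₀ P.L P.Lθ s τ : ℕ) : ℝ) ≤ P.𝔅 ^ 2 * Real.exp (1 * (P.𝔘 / (2 * cL'))) := by
    unfold Dclear
    rw [Nat.cast_mul, Nat.cast_mul]
    have h1 : ((nuBound (scale P.J₀ 0 * s) P.hpar ^ τ.1 : ℕ) : ℝ) ≤ P.𝔅 ^ 1 := by
      rw [Nat.cast_pow, pow_one]; exact P.nuBound_pow_le_𝔅 hx hτ1
    have h2 : ((S.bθ.natAbs ^ (∑ j, τ.2 j) : ℕ) : ℝ) ≤ P.𝔅 ^ 1 := by rw [pow_one]; exact hy.natAbs_bθ_pow_le hτ2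
    have h3 : (((∏ j, (S.α j).den ^ (P.L j * s)) * S.θ.den ^ (P.Lθ * s) : ℕ) : ℝ) ≤ Real.exp (1 * (P.𝔘 / (2 * cL'))) := by
      have key := hy.den_prod_le (c := 1) (e := fun j => P.L j * s) (eθ := P.Lθ * s)
        (fun j => by rw [one_mul]; exact Nat.mul_le_mul_left _ hs.le)
        (by rw [one_mul]; exact Nat.mul_le_mul_left _ hs.le)
      push_cast at key ⊢
      exact key
    have h12 := P.mul_le_𝔅_pow h1 h2 (Nat.cast_nonneg _)
    exact mul_le_mul h12 h3 (Nat.cast_nonneg _) (by positivity)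
  -- the term `≤ 𝔅² E₁`
  have hQ : |(S.qTerm (h := P.hpar) P.J₀ 0 u τ s : ℝ)| ≤ P.𝔅 ^ 2 * Real.exp (1 * (P.𝔘 / (2 * cL'))) := by
    unfold qTerm; push_cast
    rw [abs_mul, abs_mul]
    have h1 : |(S.qΔ (h := P.hpar) P.J₀ 0 u τ.1 s : ℝ)| ≤ P.𝔅 ^ 1 := by rw [pow_one]; exact w80_abs_qΔ_le P (Nat.zero_le _) u hs' hτ1
    have h2 : |(S.qA u τ.2 : ℝ)| ≤ P.𝔅 ^ 1 := by rw [pow_one]; exact hy.abs_qA_le hu hτ2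
    have h3 : |(S.qE u s : ℝ)| ≤ Real.exp (1 * (P.𝔘 / (2 * cL'))) := hy.abs_qE_le hu hs.le
    have h12 := P.mul_le_𝔅_pow h1 h2 (abs_nonneg _)
    exact mul_le_mul h12 h3 (abs_nonneg _) (by positivity)
  rw [abs_mul, Nat.abs_cast]
  calc ((S.Dclear (h := P.hpar) P.J₀ P.L P.Lθ s τ : ℕ) : ℝ) * |(S.qTerm (h := P.hpar) P.J₀ 0 u τ s : ℝ)|
      ≤ (P.𝔅 ^ 2 * Real.exp (1 * (P.𝔘 / (2 * cL')))) * (P.𝔅 ^ 2 * Real.exp (1 * (P.𝔘 / (2 * cL')))) :=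
        mul_le_mul hD hQ (abs_nonneg _) (by positivity)
    _ = P.𝔅 ^ 4 * Real.exp (2 * (P.𝔘 / (2 * cL'))) := by
        rw [show (2 : ℝ) * (P.𝔘 / (2 * cL')) = 1 * (P.𝔘 / (2 * cL')) + 1 * (P.𝔘 / (2 * cL')) by ring, Real.exp_add]; ring

/-- **`|rHalf| ≤ 𝔅² E₁²`** on the box of level `J < J₀`, `|τ| ≤ T`, `s < 2^{J+1} S₀`.
[cite: Waldschmidt1980, §3.4 (3.22) (p. 270)] -/
theorem W80Hyp.abs_rHalf_le {J : ℕ} (hJ : J < P.J₀) {u : Idx S.d P.hpar P.Lb}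
    (hu : u ∈ S.box (h := P.hpar) (Lb := P.Lb) P.L P.Lθ J) {τ : Tau S.d} (hτ : tauNorm τ ≤ P.T)
    {s : ℕ} (hs : s < 2 ^ (J + 1) * P.S₀) :
    |(S.rHalf (h := P.hpar) P.J₀ J u τ s : ℝ)| ≤ P.𝔅 ^ 2 * Real.exp (2 * (P.𝔘 / (2 * cL'))) := by
  have hτ1 : τ.1 ≤ P.T := by unfold tauNorm at hτ; omega
  have hτ2 : ∑ j, τ.2 j ≤ P.T := by unfold tauNorm at hτ; omega
  have hs' : s ≤ 2 ^ (S.d + 1 + (J + 1)) * P.S₀ := by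
    have : 2 ^ (J + 1) * P.S₀ ≤ 2 ^ (S.d + 1 + (J + 1)) * P.S₀ :=
      Nat.mul_le_mul_right _ (Nat.pow_le_pow_right two_pos (by omega))
    omega
  unfold rHalf; push_cast
  rw [abs_mul, abs_mul]
  have h1 : |(S.qΔ (h := P.hpar) P.J₀ (J + 1) u τ.1 s : ℝ)| ≤ P.𝔅 ^ 1 := by
    rw [pow_one]; exact w80_abs_qΔ_le P hJ u hs' hτ1
  have h2 : |(S.qA u τ.2 : ℝ)| ≤ P.𝔅 ^ 1 := by rw [pow_one]; exact hy.abs_qA_le hu hτ2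
  have h3 : |(S.qEh u s : ℝ)| ≤ Real.exp (2 * (P.𝔘 / (2 * cL'))) := hy.abs_qEh_le hu hs.le
  have h12 := P.mul_le_𝔅_pow h1 h2 (abs_nonneg _)
  exact mul_le_mul h12 h3 (abs_nonneg _) (by positivity)

/-- **`Dhalf ≤ 𝔅² E₁²`** for `J < J₀`, `|τ| ≤ T`, `s < 2^{J+1} S₀`. [cite: Waldschmidt1980, §3.4 (3.22) (p. 270)] -/
theorem W80Hyp.Dhalf_le {J : ℕ} (hJ : J < P.J₀) {τ : Tau S.d} (hτ : tauNorm τ ≤ P.T)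
    {s : ℕ} (hs : s < 2 ^ (J + 1) * P.S₀) :
    ((S.Dhalf (h := P.hpar) P.J₀ J P.L P.Lθ s τ : ℕ) : ℝ) ≤ P.𝔅 ^ 2 * Real.exp (2 * (P.𝔘 / (2 * cL'))) := by
  have hτ1 : τ.1 ≤ P.T := by unfold tauNorm at hτ; omega
  have hτ2 : ∑ j, τ.2 j ≤ P.T := by unfold tauNorm at hτ; omega
  have hs' : s ≤ 2 ^ (S.d + 1 + (J + 1)) * P.S₀ := by
    have : 2 ^ (J + 1) * P.S₀ ≤ 2 ^ (S.d + 1 + (J + 1)) * P.S₀ :=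
      Nat.mul_le_mul_right _ (Nat.pow_le_pow_right two_pos (by omega))
    omega
  have hx : ((scale P.J₀ (J + 1) * s : ℕ) : ℝ) ≤ P.Xpt := w80_scale_mul_le_Xpt P hJ hs'
  unfold Dhalf
  rw [Nat.cast_mul, Nat.cast_mul]
  have h1 : ((nuBound (scale P.J₀ (J + 1) * s) P.hpar ^ τ.1 : ℕ) : ℝ) ≤ P.𝔅 ^ 1 := by
    rw [Nat.cast_pow, pow_one]; exact P.nuBound_pow_le_𝔅 hx hτ1
  have h2 : ((S.bθ.natAbs ^ (∑ j, τ.2 j) : ℕ) : ℝ) ≤ P.𝔅 ^ 1 := by rw [pow_one]; exact hy.natAbs_bθ_pow_le hτ2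
  have hdiv : ∀ Lq : ℕ, Lq / 2 ^ J * s ≤ 2 * Lq * P.S₀ := by
    intro Lq
    calc Lq / 2 ^ J * s ≤ (Lq / 2 ^ J) * (2 ^ (J + 1) * P.S₀) := Nat.mul_le_mul_left _ hs.le
      _ = 2 * ((Lq / 2 ^ J) * 2 ^ J) * P.S₀ := by rw [pow_succ]; ring
      _ ≤ 2 * Lq * P.S₀ := by
          have := Nat.div_mul_le_self Lq (2 ^ J)
          exact Nat.mul_le_mul_right _ (Nat.mul_le_mul_left _ this)
  have h3 : (((∏ j, (S.α j).den ^ (P.L j / 2 ^ J * s)) * S.θ.den ^ (P.Lθ / 2 ^ J * s) : ℕ) : ℝ) ≤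
      Real.exp (2 * (P.𝔘 / (2 * cL'))) := by
    have := hy.den_prod_le (c := 2) (fun j => hdiv (P.L j)) (hdiv P.Lθ)
    push_cast at this ⊢
    exact this
  have h12 := P.mul_le_𝔅_pow h1 h2 (Nat.cast_nonneg _)
  exact mul_le_mul h12 h3 (Nat.cast_nonneg _) (by positivity)

/-- **`DclearJ ≤ 𝔅² E₁^{2^{k+1}}`** at level `J ≤ J₀` for the integer points `s < 2^{k+1+J} S₀`
(`k ≤ d`), `|τ| ≤ T`. [cite: Waldschmidt1980, §3.4 (3.21) (p. 269)] -/
theorem W80Hyp.DclearJ_le {J k : ℕ} (hJ : J ≤ P.J₀) (hk : k ≤ S.d) {τ : Tau S.d} (hτ : tauNorm τ ≤ P.T)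
    {s : ℕ} (hs : s < 2 ^ (k + 1 + J) * P.S₀) :
    ((S.DclearJ (h := P.hpar) P.J₀ J P.L P.Lθ s τ : ℕ) : ℝ) ≤
      P.𝔅 ^ 2 * Real.exp ((2 ^ (k + 1) : ℕ) * (P.𝔘 / (2 * cL'))) := by
  have hτ1 : τ.1 ≤ P.T := by unfold tauNorm at hτ; omega
  have hτ2 : ∑ j, τ.2 j ≤ P.T := by unfold tauNorm at hτ; omega
  have hs' : s ≤ 2 ^ (S.d + 1 + J) * P.S₀ := by
    have : 2 ^ (k + 1 + J) * P.S₀ ≤ 2 ^ (S.d + 1 + J) * P.S₀ :=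
      Nat.mul_le_mul_right _ (Nat.pow_le_pow_right two_pos (by omega))
    omega
  have hx : ((scale P.J₀ J * s : ℕ) : ℝ) ≤ P.Xpt := w80_scale_mul_le_Xpt P hJ hs'
  unfold DclearJ
  rw [Nat.cast_mul, Nat.cast_mul]
  have h1 : ((nuBound (scale P.J₀ J * s) P.hpar ^ τ.1 : ℕ) : ℝ) ≤ P.𝔅 ^ 1 := by
    rw [Nat.cast_pow, pow_one]; exact P.nuBound_pow_le_𝔅 hx hτ1
  have h2 : ((S.bθ.natAbs ^ (∑ j, τ.2 j) : ℕ) : ℝ) ≤ P.𝔅 ^ 1 := by rw [pow_one]; exact hy.natAbs_bθ_pow_le hτ2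
  have hdiv : ∀ Lq : ℕ, Lq / 2 ^ J * s ≤ 2 ^ (k + 1) * Lq * P.S₀ := by
    intro Lq
    calc Lq / 2 ^ J * s ≤ (Lq / 2 ^ J) * (2 ^ (k + 1 + J) * P.S₀) := Nat.mul_le_mul_left _ hs.le
      _ = 2 ^ (k + 1) * ((Lq / 2 ^ J) * 2 ^ J) * P.S₀ := by rw [pow_add]; ring
      _ ≤ 2 ^ (k + 1) * Lq * P.S₀ := by
          have := Nat.div_mul_le_self Lq (2 ^ J)
          exact Nat.mul_le_mul_right _ (Nat.mul_le_mul_left _ this)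
  have h3 : (((∏ j, (S.α j).den ^ (P.L j / 2 ^ J * s)) * S.θ.den ^ (P.Lθ / 2 ^ J * s) : ℕ) : ℝ) ≤
      Real.exp ((2 ^ (k + 1) : ℕ) * (P.𝔘 / (2 * cL'))) :=
    hy.den_prod_le (c := 2 ^ (k + 1)) (fun j => hdiv (P.L j)) (hdiv P.Lθ)
  have h12 := P.mul_le_𝔅_pow h1 h2 (Nat.cast_nonneg _)
  exact mul_le_mul h12 h3 (Nat.cast_nonneg _) (by positivity)

omit hy in
/-- **Smallness.** Under `|Λ₀| ≤ e^{−U}`: `L_θ |Λ₀| ≤ 1`, and for the parameter `x` of Lemma 9 at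
level `J`, step `k ≤ d`: `(L_θ/2^J) |Λ₀| · 65 · 2^{k+J} S₀ ≤ 𝔅 e^{−U} ≤ 1`. [folklore] -/
theorem w80_smallness (P : W80Par S.d) (hΛ : |S.Λ₀| ≤ Real.exp (-P.U)) :
    (P.Lθ : ℝ) * |S.Λ₀| ≤ 1 ∧ P.𝔅 * Real.exp (-P.U) ≤ 1 ∧
      ∀ J k : ℕ, k ≤ S.d → ((P.Lθ / 2 ^ J : ℕ) : ℝ) * |S.Λ₀| * (65 * ((2 ^ (k + J) * P.S₀ : ℕ) : ℝ)) ≤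
        P.𝔅 * Real.exp (-P.U) := by
  have hU := P.𝔘_pos
  have hUU : P.𝔘 ≤ P.U := by
    rw [P.U_eq]
    have : (1 : ℝ) ≤ 2 ^ (S.d + 1) := one_le_pow₀ (by norm_num)
    nlinarith
  have hLS := P.LθS₀_le
  have hS1 : (1 : ℝ) ≤ P.S₀ := by have := P.two_le_S₀; exact_mod_cast (by omega : 1 ≤ P.S₀)
  have hL0 : (0 : ℝ) ≤ P.Lθ := Nat.cast_nonneg _
  have hLθU : (P.Lθ : ℝ) ≤ P.𝔘 := by
    have : (P.Lθ : ℝ) ≤ P.Lθ * P.S₀ := le_mul_of_one_le_right hL0 hS1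
    have h2 : P.𝔘 / 2 ^ 14 ≤ P.𝔘 := div_le_self hU.le (by norm_num)
    linarith
  have hexpU : P.U ≤ Real.exp P.U := by linarith [Real.add_one_le_exp P.U]
  have hprod : Real.exp P.U * Real.exp (-P.U) = 1 := by rw [← Real.exp_add]; simp
  have habs := abs_nonneg S.Λ₀
  have h𝔅 := P.𝔅_pos
  refine ⟨?_, ?_, ?_⟩
  · calc (P.Lθ : ℝ) * |S.Λ₀| ≤ Real.exp P.U * Real.exp (-P.U) :=
        mul_le_mul (hLθU.trans (hUU.trans hexpU)) hΛ habs (Real.exp_pos _).le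
      _ = 1 := hprod
  · -- `𝔅 = exp(𝔘/64) ≤ exp(U)`
    unfold W80Par.𝔅
    rw [← Real.exp_add]
    apply Real.exp_le_one_iff.mpr
    linarith
  · intro J k hk
    -- `(Lθ/2^J) · 65 · 2^{k+J} S₀ ≤ 65 · 2^k · Lθ S₀ ≤ 65 · 2^d 𝔘/2^14 ≤ U ≤ 𝔅`
    have h1 : ((P.Lθ / 2 ^ J : ℕ) : ℝ) * (65 * ((2 ^ (k + J) * P.S₀ : ℕ) : ℝ)) ≤ 65 * 2 ^ k * ((P.Lθ : ℝ) * P.S₀) := by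
      have h2 : ((P.Lθ / 2 ^ J : ℕ) : ℝ) ≤ (P.Lθ : ℝ) / 2 ^ J := by
        have := Nat.cast_div_le (α := ℝ) (m := P.Lθ) (n := 2 ^ J)
        push_cast at this; exact this
      have h3 : (0 : ℝ) ≤ 65 * ((2 ^ (k + J) * P.S₀ : ℕ) : ℝ) := by positivity
      calc ((P.Lθ / 2 ^ J : ℕ) : ℝ) * (65 * ((2 ^ (k + J) * P.S₀ : ℕ) : ℝ))
          ≤ (P.Lθ : ℝ) / 2 ^ J * (65 * ((2 ^ (k + J) * P.S₀ : ℕ) : ℝ)) := mul_le_mul_of_nonneg_right h2 h3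
        _ = 65 * 2 ^ k * ((P.Lθ : ℝ) * P.S₀) := by push_cast; rw [pow_add]; field_simp
    have h4 : 65 * 2 ^ k * ((P.Lθ : ℝ) * P.S₀) ≤ P.𝔅 := by
      have h5 : (2 : ℝ) ^ k ≤ 2 ^ S.d := pow_le_pow_right₀ (by norm_num) hk
      have h6 : 65 * 2 ^ k * ((P.Lθ : ℝ) * P.S₀) ≤ 65 * 2 ^ S.d * (P.𝔘 / 2 ^ 14) := by gcongr
      have h7 : 65 * 2 ^ S.d * (P.𝔘 / 2 ^ 14) ≤ P.U := by
        rw [P.U_eq]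
        have e : (65 : ℝ) * 2 ^ S.d * (P.𝔘 / 2 ^ 14) = (2 ^ S.d * P.𝔘) * (65 / 2 ^ 14) := by ring
        have e2 : (2 : ℝ) ^ (S.d + 1) * P.𝔘 = (2 ^ S.d * P.𝔘) * 2 := by rw [pow_succ]; ring
        rw [e, e2]
        have h2d : (0 : ℝ) ≤ 2 ^ S.d * P.𝔘 := by positivity
        exact mul_le_mul_of_nonneg_left (by norm_num) h2d
      exact h6.trans (h7.trans P.U_le_𝔅)
    calc ((P.Lθ / 2 ^ J : ℕ) : ℝ) * |S.Λ₀| * (65 * ((2 ^ (k + J) * P.S₀ : ℕ) : ℝ))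
        = (((P.Lθ / 2 ^ J : ℕ) : ℝ) * (65 * ((2 ^ (k + J) * P.S₀ : ℕ) : ℝ))) * |S.Λ₀| := by ring
      _ ≤ P.𝔅 * Real.exp (-P.U) := mul_le_mul (h1.trans h4) hΛ habs h𝔅.le

omit hy in
/-- **`#box_J ≤ 𝔅`**: `#box_J ≤ h L_b ∏ (Lallᵢ + 1) ≤ (2U)^{d+2}`, `log ≤ (d+2)(1 + 10 W⋆) ≤ 22 m W⋆ ≤ 2⁻⁸⁵ 𝔘`.
[folklore] -/
theorem w80_card_box_le_𝔅 (P : W80Par S.d) (J : ℕ) :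
    ((S.box (h := P.hpar) (Lb := P.Lb) P.L P.Lθ J).card : ℝ) ≤ P.𝔅 := by
  rw [S.card_box]
  push_cast
  have hU := P.U_pos
  have hU1 : (1 : ℝ) ≤ P.U := by
    have h2 := P.𝔘_ge'
    have h5 : P.𝔘 ≤ P.U := by
      rw [P.U_eq]; have : (1 : ℝ) ≤ 2 ^ (S.d + 1) := one_le_pow₀ (by norm_num)
      nlinarith [P.𝔘_pos]
    linarith [show (1 : ℝ) ≤ 2 ^ 98 by norm_num]
  have hY : ∀ i, ((P.Lall i / 2 ^ J : ℕ) : ℝ) + 1 ≤ 2 * P.U := by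
    intro i
    have h1 : ((P.Lall i / 2 ^ J : ℕ) : ℝ) ≤ P.Lall i := by exact_mod_cast Nat.div_le_self _ _
    have h2 := P.Lall_le_U i
    linarith
  have hhLb : (P.hpar : ℝ) * P.Lb ≤ 2 * P.U := by
    have h1 := P.hparLb_le; have h2 := P.Wstar_le_𝔘; have h3 := P.𝔘_pos
    have h5 : P.𝔘 ≤ P.U := by
      rw [P.U_eq]; have : (1:ℝ) ≤ 2 ^ (S.d + 1) := one_le_pow₀ (by norm_num)
      nlinarith
    have : P.𝔘 / cL + 3 * P.Wstar ≤ 2 * P.𝔘 := by unfold cL; nlinarith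
    linarith
  have hprod : (∏ j, (((P.L j / 2 ^ J : ℕ) : ℝ) + 1)) ≤ (2 * P.U) ^ S.d := by
    calc (∏ j, (((P.L j / 2 ^ J : ℕ) : ℝ) + 1)) ≤ ∏ _j : Fin S.d, (2 * P.U) :=
          prod_le_prod (fun j _ => by positivity) fun j _ => by simpa using hY (Fin.castSucc j)
      _ = (2 * P.U) ^ S.d := by simp
  have hθ : (((P.Lθ / 2 ^ J : ℕ) : ℝ) + 1) ≤ 2 * P.U := by simpa using hY (Fin.last S.d)
  have htot : (P.hpar : ℝ) * P.Lb * ((∏ j, (((P.L j / 2 ^ J : ℕ) : ℝ) + 1)) * (((P.Lθ / 2 ^ J : ℕ) : ℝ) + 1)) ≤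
      (2 * P.U) ^ (S.d + 2) := by
    calc (P.hpar : ℝ) * P.Lb * ((∏ j, (((P.L j / 2 ^ J : ℕ) : ℝ) + 1)) * (((P.Lθ / 2 ^ J : ℕ) : ℝ) + 1))
        ≤ (2 * P.U) * ((2 * P.U) ^ S.d * (2 * P.U)) := by
          refine mul_le_mul hhLb (mul_le_mul hprod hθ (by positivity) (by positivity)) (by positivity) (by positivity)
      _ = (2 * P.U) ^ (S.d + 2) := by ring
  refine htot.trans (P.le_𝔅_of_log_le ?_)
  rw [Real.log_pow, Real.log_mul (by norm_num) hU.ne']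
  have hlog := P.log_U_le
  have hl2 : Real.log 2 ≤ 1 := by linarith [Real.log_two_lt_d9]
  have hmW := P.mW_le_𝔘; have hW := P.one_le_Wstar; have h𝔘 := P.𝔘_pos
  have hm : ((S.d + 2 : ℕ) : ℝ) ≤ 2 * mR S.d := by
    have hd1 : (1 : ℝ) ≤ S.d := by exact_mod_cast P.hd
    unfold mR; push_cast; linarith
  calc ((S.d + 2 : ℕ) : ℝ) * (Real.log 2 + Real.log P.U) ≤ (2 * mR S.d) * (1 + 10 * P.Wstar) := by
        refine mul_le_mul hm (by linarith) ?_ (by have := mR_pos P; linarith)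
        have : 0 ≤ Real.log P.U := Real.log_nonneg hU1
        have : 0 ≤ Real.log 2 := Real.log_nonneg one_le_two
        linarith
    _ ≤ (2 * mR S.d) * (11 * P.Wstar) := by
        refine mul_le_mul_of_nonneg_left (by linarith) (by have := mR_pos P; linarith)
    _ = 22 * (mR S.d * P.Wstar) := by ring
    _ ≤ P.𝔘 / 64 := by nlinarith

omit hy in
/-- **The count of Lemma 3.2**: twice the number of equations `(s, τ)`, `s < S₀`, `|τ| < T`, is at
most the number of unknowns `#box₀ = h L_b ∏(Lallᵢ + 1)` — with the factorial of
`#tauSet ≤ (T+d)^{d+1}/(d+1)!` against the `m^{2m+1}/m!` of `U`.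
[cite: Waldschmidt1980, Lemma 3.2 and (3.6) (pp. 264–267)] -/
theorem w80_siegel_count (P : W80Par S.d) :
    2 * ((range P.S₀) ×ˢ tauSet S.d P.T).card ≤ (S.box (h := P.hpar) (Lb := P.Lb) P.L P.Lθ 0).card := by
  rw [S.card_box, card_product, card_range]
  simp only [pow_zero, Nat.div_one]
  -- pass to the reals
  have hprodL : (∏ j, (P.L j + 1)) * (P.Lθ + 1) = ∏ i, (P.Lall i + 1) := by
    rw [Fin.prod_univ_castSucc]; simp
  rw [hprodL]
  suffices key : (2 : ℝ) * (P.S₀ * ((tauSet S.d P.T).card : ℝ)) ≤ P.hpar * P.Lb * ∏ i, ((P.Lall i : ℝ) + 1) by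
    exact_mod_cast key
  -- notation and basic facts
  have hm0 := mR_pos P; have hm2 := two_le_mR P
  have hW := P.one_le_Wstar; have hG := P.G_pos; have hU := P.U_pos; have h𝔘 := P.𝔘_pos
  have hS := P.S₀_pos; have hT := P.T_pos
  have em : ((S.d + 1 : ℕ) : ℝ) = mR S.d := by unfold mR; push_cast; ring
  -- (1) the count of `τ`
  have h1 : ((tauSet S.d P.T).card : ℝ) ≤ (2 * (P.T : ℝ)) ^ (S.d + 1) / (S.d + 1).factorial := by
    have h := Waldschmidt1980.card_tauSet_le_pow_div_factorial S.d P.T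
    have hTd : (P.T : ℝ) + S.d ≤ 2 * P.T := by
      -- `d ≤ T` from `T ≥ 2^{11} m² Vθ Lθ ≥ 2^{11} m²`
      have h2 := P.T_ge_Lθ
      have hL : (1 : ℝ) ≤ P.Lθ := by exact_mod_cast P.one_le_Lθ
      have hV := P.one_le_Vθ
      have hd : (S.d : ℝ) ≤ mR S.d := by unfold mR; linarith
      have : (S.d : ℝ) ≤ 2 ^ 11 * mR S.d ^ 2 * P.Vθ * P.Lθ := by
        have h3 : mR S.d ≤ 2 ^ 11 * mR S.d ^ 2 * P.Vθ * P.Lθ := by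
          calc mR S.d = 1 * (mR S.d * 1) * 1 * 1 := by ring
            _ ≤ 2 ^ 11 * (mR S.d * mR S.d) * P.Vθ * P.Lθ := by gcongr <;> linarith
            _ = 2 ^ 11 * mR S.d ^ 2 * P.Vθ * P.Lθ := by ring
        linarith
      linarith
    calc ((tauSet S.d P.T).card : ℝ) ≤ ((P.T : ℝ) + S.d) ^ (S.d + 1) / (S.d + 1).factorial := h
      _ ≤ (2 * (P.T : ℝ)) ^ (S.d + 1) / (S.d + 1).factorial := by gcongr
  -- (2) `T ≤ 𝔘/(c_T W⋆)`
  have h2 : (P.T : ℝ) ≤ P.𝔘 / (cT * P.Wstar) := by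
    have := P.T_le
    rw [P.U_eq] at this
    have e : 2 ^ (S.d + 1) * P.𝔘 / (cT * 2 ^ (S.d + 1) * P.Wstar) = P.𝔘 / (cT * P.Wstar) := by
      unfold cT; field_simp
    rw [← e]; exact this
  -- (3) the lower bounds for the unknowns
  have h3 : P.𝔘 / (cL * P.G) ≤ (P.hpar : ℝ) * P.Lb := by
    have hh := P.hpar_pos
    have hLb : P.U / (cL * 2 ^ (S.d + 1) * P.G * P.hpar) ≤ (P.Lb : ℝ) := by
      unfold W80Par.Lb; push_cast; exact (Nat.lt_floor_add_one _).le
    have e : P.U / (cL * 2 ^ (S.d + 1) * P.G * P.hpar) = P.𝔘 / (cL * P.G) / P.hpar := by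
      rw [P.U_eq]; unfold cL; field_simp
    rw [e, div_le_iff₀ hh] at hLb
    linarith
  have h4 : ∀ i, P.U / (cL' * mR S.d * 2 ^ (S.d + 2) * P.S₀ * P.Vall i) ≤ (P.Lall i : ℝ) + 1 := by
    intro i
    refine Fin.lastCases ?_ (fun j => ?_) i
    · rw [P.Lall_last, P.Vall_last]; unfold W80Par.Lθ; exact (Nat.lt_floor_add_one _).le
    · rw [P.Lall_castSucc, P.Vall_castSucc]; unfold W80Par.L; exact (Nat.lt_floor_add_one _).le
  set D : ℝ := cL' * mR S.d * 2 ^ (S.d + 2) * P.S₀ with hD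
  have hD0 : 0 < D := by rw [hD]; unfold cL'; positivity
  have h5 : P.U ^ (S.d + 1) / (D ^ (S.d + 1) * ∏ i, P.Vall i) ≤ ∏ i, ((P.Lall i : ℝ) + 1) := by
    have e : P.U ^ (S.d + 1) / (D ^ (S.d + 1) * ∏ i, P.Vall i) = ∏ i, (P.U / (D * P.Vall i)) := by
      rw [prod_div_distrib, prod_const, card_univ, Fintype.card_fin, prod_mul_distrib, prod_const, card_univ,
        Fintype.card_fin]
    rw [e]
    refine prod_le_prod (fun i _ => by have := P.Vall_pos i; positivity) fun i _ => ?_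
    have := h4 i
    rwa [show cL' * mR S.d * 2 ^ (S.d + 2) * (P.S₀ : ℝ) * P.Vall i = D * P.Vall i by rw [hD]] at this
  -- (4) the numerical heart: `2 S₀ (2𝔘/(c_T W⋆))^m/m! ≤ (𝔘/(c_L G)) · U^m/(D^m ∏Vall)`
  have hVall : 0 < ∏ i, P.Vall i := prod_pos fun i _ => P.Vall_pos i
  have hfac : (0 : ℝ) < (S.d + 1).factorial := by exact_mod_cast Nat.factorial_pos _
  set A₁ : ℝ := 2 * P.S₀ * (2 * P.𝔘) ^ (S.d + 1) with hA₁
  set B₁ : ℝ := (cT * P.Wstar) ^ (S.d + 1) * (S.d + 1).factorial with hB₁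
  set A₂ : ℝ := P.𝔘 * P.U ^ (S.d + 1) with hA₂
  set B₂ : ℝ := cL * P.G * (D ^ (S.d + 1) * ∏ i, P.Vall i) with hB₂
  have hB₁0 : 0 < B₁ := by rw [hB₁]; unfold cT; positivity
  have hB₂0 : 0 < B₂ := by rw [hB₂]; unfold cL; positivity
  have eL : 2 * ((P.S₀ : ℝ) * ((2 * (P.𝔘 / (cT * P.Wstar))) ^ (S.d + 1) / (S.d + 1).factorial)) = A₁ / B₁ := by
    rw [hA₁, hB₁, show (2 : ℝ) * (P.𝔘 / (cT * P.Wstar)) = (2 * P.𝔘) / (cT * P.Wstar) by ring, div_pow,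
      div_div, mul_div_assoc, mul_assoc]
  have eR : (P.𝔘 / (cL * P.G)) * (P.U ^ (S.d + 1) / (D ^ (S.d + 1) * ∏ i, P.Vall i)) = A₂ / B₂ := by
    rw [hA₂, hB₂, div_mul_div_comm]
  have heart : A₁ / B₁ ≤ A₂ / B₂ := by
    rw [div_le_div_iff₀ hB₁0 hB₂0, hA₁, hB₁, hA₂, hB₂]
    -- `2 S₀ (2𝔘)^m · c_L G D^m ∏Vall ≤ 𝔘 U^m · (c_T W⋆)^m m!`
    rw [P.U_eq]
    have hprodV : (∏ i, P.Vall i) = (∏ j, P.V j) * P.Vθ := by rw [Fin.prod_univ_castSucc]; simp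
    have h𝔘eq : P.𝔘 * ((S.d + 1).factorial : ℝ) * 2 ^ (S.d + 1) =
        W80Par.A ^ (S.d + 1) * mR S.d ^ (2 * S.d + 3) * ((∏ j, P.V j) * P.Vθ) * P.Wstar * P.G := by
      unfold W80Par.𝔘 W80Par.U; field_simp
    have hS₀ := P.S₀_le
    have hS0' : (0 : ℝ) ≤ P.S₀ := hS.le
    have LHS_le : 2 * (P.S₀ : ℝ) * (2 * P.𝔘) ^ (S.d + 1) * (cL * P.G * (D ^ (S.d + 1) * ∏ i, P.Vall i)) ≤
        2 * (2 * (cS * mR S.d * P.Wstar)) * (2 * P.𝔘) ^ (S.d + 1) *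
          (cL * P.G * ((cL' * mR S.d * 2 ^ (S.d + 2) * (2 * (cS * mR S.d * P.Wstar))) ^ (S.d + 1) * ∏ i, P.Vall i)) := by
      have hDle : D ≤ cL' * mR S.d * 2 ^ (S.d + 2) * (2 * (cS * mR S.d * P.Wstar)) := by
        rw [hD]; unfold cL'; gcongr
      have hcS : (0 : ℝ) < cS := by unfold cS; norm_num
      have hcL : (0 : ℝ) < cL := by unfold cL; norm_num
      have h0 : (0 : ℝ) ≤ 2 * (2 * (cS * mR S.d * P.Wstar)) * (2 * P.𝔘) ^ (S.d + 1) := by positivity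
      gcongr
    refine LHS_le.trans ?_
    have e3 : ((2 : ℝ) ^ (S.d + 1)) ^ (S.d + 1) = (2 ^ (S.d + 1)) ^ S.d * 2 ^ (S.d + 1) := pow_succ _ _
    have eRR : P.𝔘 * (2 ^ (S.d + 1) * P.𝔘) ^ (S.d + 1) * ((cT * P.Wstar) ^ (S.d + 1) * (S.d + 1).factorial) =
        (P.𝔘 * ((S.d + 1).factorial : ℝ) * 2 ^ (S.d + 1)) * (2 ^ (S.d + 1)) ^ S.d * P.𝔘 ^ (S.d + 1) * cT ^ (S.d + 1) *
          P.Wstar ^ (S.d + 1) := by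
      rw [mul_pow, mul_pow, e3]; ring
    rw [eRR, h𝔘eq, hprodV]
    unfold cS cL cL' cT
    set M : ℝ := mR S.d ^ (2 * S.d + 3) * ((∏ j, P.V j) * P.Vθ) * P.Wstar * P.G * P.𝔘 ^ (S.d + 1) * P.Wstar ^ (S.d + 1)
      with hM
    have key : (2 : ℝ) * (2 * (2 ^ 13 * mR S.d * P.Wstar)) * (2 * P.𝔘) ^ (S.d + 1) *
        (2 ^ 14 * P.G * ((2 ^ 12 * mR S.d * 2 ^ (S.d + 2) * (2 * (2 ^ 13 * mR S.d * P.Wstar))) ^ (S.d + 1) * ((∏ j, P.V j) * P.Vθ)))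
        = ((2 : ℝ) ^ 1 * 2 ^ 1 * 2 ^ 13 * 2 ^ 14 * 2 ^ (S.d + 1) * (2 ^ 12 * 2 ^ (S.d + 2) * 2 ^ 1 * 2 ^ 13) ^ (S.d + 1)) * M := by
      rw [hM]
      have e1 : mR S.d ^ (2 * S.d + 3) = mR S.d * (mR S.d * mR S.d) ^ (S.d + 1) := by ring
      rw [e1]; ring
    rw [key]
    have key2 : W80Par.A ^ (S.d + 1) * mR S.d ^ (2 * S.d + 3) * ((∏ j, P.V j) * P.Vθ) * P.Wstar * P.G *
        (2 ^ (S.d + 1)) ^ S.d * P.𝔘 ^ (S.d + 1) * (2 ^ 14) ^ (S.d + 1) * P.Wstar ^ (S.d + 1)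
        = (W80Par.A ^ (S.d + 1) * ((2 : ℝ) ^ (S.d + 1)) ^ S.d * (2 ^ 14) ^ (S.d + 1)) * M := by
      rw [hM]; ring
    rw [key2]
    have hVV : 0 ≤ (∏ j, P.V j) * P.Vθ := by rw [← hprodV]; exact hVall.le
    have hM0 : 0 ≤ M := by rw [hM]; positivity
    refine mul_le_mul_of_nonneg_right ?_ hM0
    -- constants: `2^{30+d} · 2^{(28+d)(d+1)} ≤ 2^{50(d+1)} · 2^{(d+1)d} · 2^{14(d+1)}`
    rw [show W80Par.A = (2 : ℝ) ^ 50 from rfl]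
    have hexp : 1 + 1 + 13 + 14 + (S.d + 1) + (12 + (S.d + 2) + 1 + 13) * (S.d + 1) ≤
        50 * (S.d + 1) + (S.d + 1) * S.d + 14 * (S.d + 1) := by
      have e : (12 + (S.d + 2) + 1 + 13) * (S.d + 1) = 28 * (S.d + 1) + (S.d + 1) * S.d := by ring
      rw [e]
      generalize (S.d + 1) * S.d = q
      omega
    calc (2 : ℝ) ^ 1 * 2 ^ 1 * 2 ^ 13 * 2 ^ 14 * 2 ^ (S.d + 1) * (2 ^ 12 * 2 ^ (S.d + 2) * 2 ^ 1 * 2 ^ 13) ^ (S.d + 1)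
        = 2 ^ (1 + 1 + 13 + 14 + (S.d + 1) + (12 + (S.d + 2) + 1 + 13) * (S.d + 1)) := by
          simp only [← pow_mul, ← pow_add]
      _ ≤ 2 ^ (50 * (S.d + 1) + (S.d + 1) * S.d + 14 * (S.d + 1)) := pow_le_pow_right₀ (by norm_num) hexp
      _ = (2 ^ 50) ^ (S.d + 1) * (2 ^ (S.d + 1)) ^ S.d * (2 ^ 14) ^ (S.d + 1) := by
          simp only [← pow_mul, ← pow_add]
  -- (5) combine
  calc (2 : ℝ) * (P.S₀ * ((tauSet S.d P.T).card : ℝ))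
      ≤ 2 * (P.S₀ * ((2 * (P.T : ℝ)) ^ (S.d + 1) / (S.d + 1).factorial)) := by gcongr
    _ ≤ 2 * (P.S₀ * ((2 * (P.𝔘 / (cT * P.Wstar))) ^ (S.d + 1) / (S.d + 1).factorial)) := by
        gcongr
    _ = A₁ / B₁ := eL
    _ ≤ A₂ / B₂ := heart
    _ = (P.𝔘 / (cL * P.G)) * (P.U ^ (S.d + 1) / (D ^ (S.d + 1) * ∏ i, P.Vall i)) := eR.symm
    _ ≤ (P.hpar * P.Lb) * ∏ i, ((P.Lall i : ℝ) + 1) := by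
        refine mul_le_mul h3 h5 (by positivity) (by positivity)
    _ = P.hpar * P.Lb * ∏ i, ((P.Lall i : ℝ) + 1) := by ring

end Setup

end Literature.NumberTheory.Transcendental.CW77

end
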